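import Mathlib

/-!
# `Aut F₃ ↠ GL₃(ℤ)` (Nielsen 1924) — candidate proof of `stub_autFreeGroupRealisesGL`

drefute gen 3 (refuter), crux stmt-SmoothPoincare4-14595, line `epi-class-livingston`, stub 1b.
`autFreeGroupRealisesGL` below has the registered signature VERBATIM. Two parts:

* `NielsenMoves`: the free-group side — `abMat θ` (row `i` = exponent-sum vector of `θ (of i)`,
  the stub's expression), `abMat_comp` (an ANTI-homomorphism), the Nielsen automorphisms
  `permEquiv`, `signEquiv`, `transvectionEquiv` as `MulEquiv`s with their matrices, and
  `stub_1b_of_generation` (realisable matrices form a submonoid containing the Nielsen matrices);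
* `GL3Gen`: the matrix side — every integer `3 × 3` matrix with unit determinant is a product of
  Nielsen matrices (`mem_closure_of_isUnit_det`: Euclid on the first column by row operations, clear
  the first row, fix two signs, then the `SL(2,ℤ)` block via Mathlib's
  `SpecialLinearGroup.SL2Z_generators`).

Positive content: evidence for a prover (lands as the stub's Theorems file / a Literature fact), not a
refuter landing. `lean check`: rc 0, 0 sorries; axioms propext / Classical.choice / Quot.sound.
-/

noncomputable section

set_option linter.dupNamespace false
set_option maxHeartbeats 800000

open scoped Matrix MatrixGroups

namespace Summit.SmoothPoincare4.SmoothPoincare4.Cruxes.ShadowApproximation.EpiClassLivingston.NielsenMoves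

/-- `F₃`. -/
abbrev F3 : Type := FreeGroup (Fin 3)

/-- Abelianisation coordinates `F₃ → ℤ³` (the hom appearing in the stub). -/
def abHom : F3 →* Multiplicative (Fin 3 → ℤ) :=
  FreeGroup.lift fun k : Fin 3 => Multiplicative.ofAdd (Pi.single k (1 : ℤ) : Fin 3 → ℤ)

@[simp] theorem abHom_of (k : Fin 3) :
    abHom (FreeGroup.of k) = Multiplicative.ofAdd (Pi.single k (1 : ℤ) : Fin 3 → ℤ) := by
  simp [abHom]

/-- The matrix of an endomorphism: row `i` = exponent-sum vector of `θ (of i)` (the stub's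
`Multiplicative.toAdd (FreeGroup.lift … (θ (FreeGroup.of i))) j`). -/
def abMat (θ : F3 →* F3) : Matrix (Fin 3) (Fin 3) ℤ :=
  Matrix.of fun i j => Multiplicative.toAdd (abHom (θ (FreeGroup.of i))) j

theorem abMat_apply (θ : F3 →* F3) (i j : Fin 3) :
    abMat θ i j = Multiplicative.toAdd (abHom (θ (FreeGroup.of i))) j := rfl

theorem abMat_row (θ : F3 →* F3) (i : Fin 3) :
    abMat θ i = Multiplicative.toAdd (abHom (θ (FreeGroup.of i))) := rfl

/-- `v ↦ v ᵥ* M` as an additive hom. -/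
def vecMulHom (M : Matrix (Fin 3) (Fin 3) ℤ) : (Fin 3 → ℤ) →+ (Fin 3 → ℤ) where
  toFun v := v ᵥ* M
  map_zero' := Matrix.zero_vecMul M
  map_add' v w := Matrix.add_vecMul M v w

@[simp] theorem vecMulHom_apply (M : Matrix (Fin 3) (Fin 3) ℤ) (v : Fin 3 → ℤ) :
    vecMulHom M v = v ᵥ* M := rfl

/-- `eᵢ ᵥ* M` is the `i`-th row. -/
theorem single_one_vecMul' (M : Matrix (Fin 3) (Fin 3) ℤ) (i : Fin 3) :
    (Pi.single i (1 : ℤ) : Fin 3 → ℤ) ᵥ* M = M i := by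
  ext j
  simp [Matrix.vecMul]

/-- Entries of `Matrix.single`. -/
theorem single_apply' (i j : Fin 3) (c : ℤ) (i' j' : Fin 3) :
    Matrix.single i j c i' j' = if i = i' ∧ j = j' then c else 0 := rfl

/-- Linearity of abelianisation: `ab(θ w) = ab(w) ᵥ* abMat θ`. -/
theorem toAdd_abHom_map (θ : F3 →* F3) (w : F3) :
    Multiplicative.toAdd (abHom (θ w)) = Multiplicative.toAdd (abHom w) ᵥ* abMat θ := by
  have key : abHom.comp θ = (AddMonoidHom.toMultiplicative (vecMulHom (abMat θ))).comp abHom := by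
    refine FreeGroup.ext_hom _ _ fun i => ?_
    rw [MonoidHom.comp_apply, MonoidHom.comp_apply, abHom_of, AddMonoidHom.coe_toMultiplicative,
      Function.comp_apply, Function.comp_apply, toAdd_ofAdd, vecMulHom_apply, single_one_vecMul',
      abMat_row, ofAdd_toAdd]
  have h1 := DFunLike.congr_fun key w
  rw [MonoidHom.comp_apply, MonoidHom.comp_apply, AddMonoidHom.coe_toMultiplicative,
    Function.comp_apply, Function.comp_apply, vecMulHom_apply] at h1
  rw [h1, toAdd_ofAdd]

/-- **Anti-multiplicativity**: `abMat (θ ∘ ψ) = abMat ψ * abMat θ`. -/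
theorem abMat_comp (θ ψ : F3 →* F3) : abMat (θ.comp ψ) = abMat ψ * abMat θ := by
  ext i j
  rw [abMat_apply, MonoidHom.comp_apply, toAdd_abHom_map, Matrix.mul_apply, ← abMat_row]
  simp [Matrix.vecMul, dotProduct]

theorem abMat_id : abMat (MonoidHom.id F3) = 1 := by
  ext i j
  rw [abMat_apply, MonoidHom.id_apply, abHom_of, toAdd_ofAdd, Matrix.one_apply, Pi.single_apply]
  simp only [eq_comm]

/-! ## Nielsen automorphisms -/

/-- Relabelling the generators by a permutation. -/
def permEquiv (σ : Equiv.Perm (Fin 3)) : F3 ≃* F3 := FreeGroup.freeGroupCongr σ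

theorem abMat_permEquiv (σ : Equiv.Perm (Fin 3)) :
    abMat (permEquiv σ).toMonoidHom = σ.toPEquiv.toMatrix := by
  ext i j
  rw [abMat_apply, MulEquiv.coe_toMonoidHom, permEquiv, FreeGroup.freeGroupCongr_apply,
    FreeGroup.map.of, abHom_of, toAdd_ofAdd, PEquiv.toMatrix_apply, Pi.single_apply]
  simp [eq_comm]

/-- Inverting the generator `k`. -/
def signHom (k : Fin 3) : F3 →* F3 :=
  FreeGroup.lift fun i => if i = k then (FreeGroup.of i)⁻¹ else FreeGroup.of i

@[simp] theorem signHom_of (k i : Fin 3) :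
    signHom k (FreeGroup.of i) = if i = k then (FreeGroup.of i)⁻¹ else FreeGroup.of i := by
  simp [signHom]

theorem signHom_comp_self (k : Fin 3) : (signHom k).comp (signHom k) = MonoidHom.id F3 := by
  refine FreeGroup.ext_hom _ _ fun i => ?_
  by_cases h : i = k
  · simp [h]
  · simp [h]

/-- The sign change at `k` as an automorphism (an involution). -/
def signEquiv (k : Fin 3) : F3 ≃* F3 :=
  MonoidHom.toMulEquiv (signHom k) (signHom k) (signHom_comp_self k) (signHom_comp_self k)

theorem abMat_signEquiv (k : Fin 3) :
    abMat (signEquiv k).toMonoidHom = Matrix.diagonal fun i => if i = k then -1 else 1 := by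
  ext i j
  rw [abMat_apply]
  change Multiplicative.toAdd (abHom (signHom k (FreeGroup.of i))) j = _
  rw [signHom_of]
  by_cases h : i = k
  · subst h
    by_cases hij : i = j
    · subst hij; simp
    · simp [hij, Ne.symm hij]
  · by_cases hij : i = j
    · subst hij; simp [h]
    · simp [h, hij, Ne.symm hij]

/-- The transvection `x_k ↦ x_k · x_l ^ c` (other generators fixed). -/
def transvectionHom (k l : Fin 3) (c : ℤ) : F3 →* F3 :=
  FreeGroup.lift fun i => if i = k then FreeGroup.of k * FreeGroup.of l ^ c else FreeGroup.of i

@[simp] theorem transvectionHom_of (k l : Fin 3) (c : ℤ) (i : Fin 3) :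
    transvectionHom k l c (FreeGroup.of i) =
      if i = k then FreeGroup.of k * FreeGroup.of l ^ c else FreeGroup.of i := by
  simp [transvectionHom]

theorem transvectionHom_comp (k l : Fin 3) (hkl : k ≠ l) (c d : ℤ) :
    (transvectionHom k l c).comp (transvectionHom k l d) = transvectionHom k l (c + d) := by
  refine FreeGroup.ext_hom _ _ fun i => ?_
  by_cases h : i = k
  · subst h
    rw [MonoidHom.comp_apply, transvectionHom_of, if_pos rfl, map_mul, map_zpow,
      transvectionHom_of, if_pos rfl, transvectionHom_of, if_neg (Ne.symm hkl),
      transvectionHom_of, if_pos rfl, mul_assoc, ← zpow_add]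
  · simp [h]

theorem transvectionHom_zero (k l : Fin 3) : transvectionHom k l 0 = MonoidHom.id F3 := by
  refine FreeGroup.ext_hom _ _ fun i => ?_
  by_cases h : i = k
  · subst h; simp
  · simp [h]

/-- The transvection as an automorphism (inverse: exponent `-c`). -/
def transvectionEquiv (k l : Fin 3) (hkl : k ≠ l) (c : ℤ) : F3 ≃* F3 :=
  MonoidHom.toMulEquiv (transvectionHom k l c) (transvectionHom k l (-c))
    (by rw [transvectionHom_comp k l hkl, neg_add_cancel, transvectionHom_zero])
    (by rw [transvectionHom_comp k l hkl, add_neg_cancel, transvectionHom_zero])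

theorem abMat_transvectionEquiv (k l : Fin 3) (hkl : k ≠ l) (c : ℤ) :
    abMat (transvectionEquiv k l hkl c).toMonoidHom = Matrix.transvection k l c := by
  ext i j
  rw [abMat_apply]
  change Multiplicative.toAdd (abHom (transvectionHom k l c (FreeGroup.of i))) j = _
  rw [transvectionHom_of, Matrix.transvection, Matrix.add_apply, Matrix.one_apply, single_apply']
  by_cases h : i = k
  · subst h
    simp only [if_true, map_mul, map_zpow, abHom_of, toAdd_mul, toAdd_zpow, toAdd_ofAdd,
      Pi.add_apply, zsmul_eq_mul, Pi.single_apply, true_and]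
    by_cases hij : i = j
    · subst hij
      simp [Ne.symm hkl, hkl]
    · by_cases hlj : l = j
      · subst hlj
        simp [Ne.symm hij, hij]
      · simp [Ne.symm hij, hij, hlj, Ne.symm hlj]
  · have hk : ¬ (k = i ∧ l = j) := fun hk => h hk.1.symm
    rw [if_neg h, abHom_of, toAdd_ofAdd, Pi.single_apply, if_neg hk, add_zero]
    by_cases hij : i = j
    · subst hij; simp
    · simp [hij, Ne.symm hij]

/-! ## Realisable matrices form a submonoid containing the Nielsen matrices -/

/-- `M` is the abelianisation matrix of an automorphism of `F₃`. -/
def Realisable (M : Matrix (Fin 3) (Fin 3) ℤ) : Prop := ∃ θ : F3 ≃* F3, abMat θ.toMonoidHom = M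

theorem realisable_one : Realisable 1 := ⟨MulEquiv.refl _, abMat_id⟩

theorem Realisable.mul {M N : Matrix (Fin 3) (Fin 3) ℤ} (hM : Realisable M) (hN : Realisable N) :
    Realisable (M * N) := by
  obtain ⟨θ, rfl⟩ := hM
  obtain ⟨ψ, rfl⟩ := hN
  refine ⟨θ.trans ψ, ?_⟩
  rw [← abMat_comp]
  rfl

/-- The Nielsen matrices: transvections (all integer coefficients, so inverses are included),
sign changes, permutation matrices. -/
def nielsenGens : Set (Matrix (Fin 3) (Fin 3) ℤ) :=
  {M | ∃ (k l : Fin 3) (_ : k ≠ l) (c : ℤ), M = Matrix.transvection k l c} ∪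
    {M | ∃ k : Fin 3, M = Matrix.diagonal fun i => if i = k then -1 else 1} ∪
    {M | ∃ σ : Equiv.Perm (Fin 3), M = σ.toPEquiv.toMatrix}

theorem realisable_of_mem_nielsenGens {M : Matrix (Fin 3) (Fin 3) ℤ} (h : M ∈ nielsenGens) :
    Realisable M := by
  rcases h with (⟨k, l, hkl, c, rfl⟩ | ⟨k, rfl⟩) | ⟨σ, rfl⟩
  · exact ⟨transvectionEquiv k l hkl c, abMat_transvectionEquiv k l hkl c⟩
  · exact ⟨signEquiv k, abMat_signEquiv k⟩
  · exact ⟨permEquiv σ, abMat_permEquiv σ⟩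

theorem realisable_of_mem_closure {M : Matrix (Fin 3) (Fin 3) ℤ}
    (h : M ∈ Submonoid.closure nielsenGens) : Realisable M := by
  induction h using Submonoid.closure_induction with
  | mem x hx => exact realisable_of_mem_nielsenGens hx
  | one => exact realisable_one
  | mul x y _ _ hx hy => exact hx.mul hy

/-- **Stub 1b from the matrix fact.** If every integer matrix with unit determinant is a product of
Nielsen matrices (`GL₃(ℤ) = ⟨transvections, signs, permutations⟩` as a monoid — column Euclid, then
the `2 × 2` block by `SpecialLinearGroup.SL2Z_generators`), then the registered stub holds
VERBATIM. -/
theorem stub_1b_of_generation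
    (hgen : ∀ M : Matrix (Fin 3) (Fin 3) ℤ, IsUnit M.det → M ∈ Submonoid.closure nielsenGens) :
    ∀ M : Matrix (Fin 3) (Fin 3) ℤ, IsUnit M.det →
      ∃ θ : FreeGroup (Fin 3) ≃* FreeGroup (Fin 3), ∀ i j : Fin 3,
        Multiplicative.toAdd (FreeGroup.lift
          (fun k : Fin 3 => Multiplicative.ofAdd (Pi.single k (1 : ℤ) : Fin 3 → ℤ))
          (θ (FreeGroup.of i))) j = M i j := by
  intro M hM
  obtain ⟨θ, hθ⟩ := realisable_of_mem_closure (hgen M hM)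
  exact ⟨θ, fun i j => by rw [← hθ]; rfl⟩

end Summit.SmoothPoincare4.SmoothPoincare4.Cruxes.ShadowApproximation.EpiClassLivingston.NielsenMoves

namespace Summit.SmoothPoincare4.SmoothPoincare4.Cruxes.ShadowApproximation.EpiClassLivingston.GL3Gen

local notation "M3" => Matrix (Fin 3) (Fin 3) ℤ

/-- Sign change at `k`. -/
def signMat (k : Fin 3) : M3 := Matrix.diagonal fun i => if i = k then -1 else 1

open NielsenMoves (nielsenGens)

/-- The monoid they generate. -/
abbrev C : Submonoid M3 := Submonoid.closure nielsenGens

theorem transvection_mem (k l : Fin 3) (hkl : k ≠ l) (c : ℤ) : Matrix.transvection k l c ∈ C :=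
  Submonoid.subset_closure (Or.inl (Or.inl ⟨k, l, hkl, c, rfl⟩))

theorem signMat_mem (k : Fin 3) : signMat k ∈ C :=
  Submonoid.subset_closure (Or.inl (Or.inr ⟨k, rfl⟩))

theorem perm_mem (σ : Equiv.Perm (Fin 3)) : (σ.toPEquiv.toMatrix : M3) ∈ C :=
  Submonoid.subset_closure (Or.inr ⟨σ, rfl⟩)

/-- Row-swap matrices. -/
def Pswap (a b : Fin 3) : M3 := (Equiv.swap a b).toPEquiv.toMatrix

theorem Pswap_mem (a b : Fin 3) : Pswap a b ∈ C := perm_mem _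

theorem Pswap_apply (a b i j : Fin 3) : Pswap a b i j = if Equiv.swap a b i = j then 1 else 0 := by
  simp [Pswap, PEquiv.toMatrix_apply]

theorem Pswap_mul_apply (a b : Fin 3) (M : M3) (i j : Fin 3) :
    (Pswap a b * M) i j = M (Equiv.swap a b i) j := by
  rw [Pswap, PEquiv.toMatrix_toPEquiv_mul]
  rfl

theorem signMat_mul_apply (k : Fin 3) (M : M3) (i j : Fin 3) :
    (signMat k * M) i j = (if i = k then -1 else 1) * M i j := by
  rw [signMat, Matrix.diagonal_mul]

/-! ## Determinants and inverses of generated matrices -/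

theorem isUnit_det_of_mem {P : M3} (h : P ∈ C) : IsUnit P.det := by
  induction h using Submonoid.closure_induction with
  | mem x hx =>
    rcases hx with (⟨k, l, hkl, c, rfl⟩ | ⟨k, rfl⟩) | ⟨σ, rfl⟩
    · rw [Matrix.det_transvection_of_ne _ _ hkl]
      exact isUnit_one
    · rw [Matrix.det_diagonal]
      fin_cases k <;> decide
    · rw [Matrix.det_permutation]
      exact Units.isUnit _
  | one => simp
  | mul x y _ _ hx hy =>
    rw [Matrix.det_mul]
    exact hx.mul hy

theorem exists_inv_of_mem {P : M3} (h : P ∈ C) : ∃ P' ∈ C, P' * P = 1 ∧ P * P' = 1 := by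
  induction h using Submonoid.closure_induction with
  | mem x hx =>
    rcases hx with (⟨k, l, hkl, c, rfl⟩ | ⟨k, rfl⟩) | ⟨σ, rfl⟩
    · refine ⟨Matrix.transvection k l (-c), transvection_mem k l hkl (-c), ?_, ?_⟩
      · rw [Matrix.transvection_mul_transvection_same k l hkl, neg_add_cancel, Matrix.transvection_zero]
      · rw [Matrix.transvection_mul_transvection_same k l hkl, add_neg_cancel, Matrix.transvection_zero]
    · refine ⟨_, signMat_mem k, ?_, ?_⟩ <;>
      · rw [signMat, Matrix.diagonal_mul_diagonal, ← Matrix.diagonal_one]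
        congr 1
        funext i
        split_ifs <;> simp
    · refine ⟨σ.symm.toPEquiv.toMatrix, perm_mem σ.symm, ?_, ?_⟩
      · rw [← PEquiv.toMatrix_trans, ← Equiv.toPEquiv_trans, Equiv.symm_trans_self,
          Equiv.toPEquiv_refl, PEquiv.toMatrix_refl]
      · rw [← PEquiv.toMatrix_trans, ← Equiv.toPEquiv_trans, Equiv.self_trans_symm,
          Equiv.toPEquiv_refl, PEquiv.toMatrix_refl]
  | one => exact ⟨1, Submonoid.one_mem _, by simp, by simp⟩
  | mul x y _ _ hx hy =>
    obtain ⟨x', hx', hx1, hx2⟩ := hx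
    obtain ⟨y', hy', hy1, hy2⟩ := hy
    refine ⟨y' * x', Submonoid.mul_mem _ hy' hx', ?_, ?_⟩
    · calc y' * x' * (x * y) = y' * (x' * x) * y := by simp [mul_assoc]
        _ = 1 := by rw [hx1, mul_one, hy1]
    · calc x * y * (y' * x') = x * (y * y') * x' := by simp [mul_assoc]
        _ = 1 := by rw [hy2, mul_one, hx2]

/-- If `L * M * R ∈ C` with `L R ∈ C` then `M ∈ C`. -/
theorem mem_of_mul_mem {L M R : M3} (hL : L ∈ C) (hR : R ∈ C) (h : L * M * R ∈ C) : M ∈ C := by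
  obtain ⟨L', hL', hL1, -⟩ := exists_inv_of_mem hL
  obtain ⟨R', hR', -, hR2⟩ := exists_inv_of_mem hR
  have : M = L' * (L * M * R) * R' := by
    calc M = (L' * L) * M * (R * R') := by rw [hL1, hR2, one_mul, mul_one]
      _ = L' * (L * M * R) * R' := by simp [mul_assoc]
  rw [this]
  exact Submonoid.mul_mem _ (Submonoid.mul_mem _ hL' h) hR'

/-! ## Column reduction (Euclid) -/

/-- Size of the first column below the diagonal. -/
def μ (M : M3) : ℕ := (M 1 0).natAbs + (M 2 0).natAbs

theorem step (M : M3) (h : M 1 0 ≠ 0) : ∃ P ∈ C, μ (P * M) < μ M := by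
  set q : ℤ := -(M 0 0 / M 1 0) with hq
  refine ⟨Pswap 0 1 * Matrix.transvection 0 1 q,
    Submonoid.mul_mem _ (Pswap_mem 0 1) (transvection_mem 0 1 (by decide) q), ?_⟩
  have e1 : (Pswap 0 1 * Matrix.transvection 0 1 q * M : M3) 1 0 = M 0 0 % M 1 0 := by
    rw [Matrix.mul_assoc, Pswap_mul_apply, Equiv.swap_apply_right,
      Matrix.transvection_mul_apply_same 0 1 0 q M, hq, Int.emod_def]
    ring
  have e2 : (Pswap 0 1 * Matrix.transvection 0 1 q * M : M3) 2 0 = M 2 0 := by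
    rw [Matrix.mul_assoc, Pswap_mul_apply, Equiv.swap_apply_of_ne_of_ne (by decide) (by decide),
      Matrix.transvection_mul_apply_of_ne 0 1 2 0 (by decide) q M]
  unfold μ
  rw [e1, e2]
  have hlt : (M 0 0 % M 1 0).natAbs < (M 1 0).natAbs := by
    have h0 := Int.emod_nonneg (M 0 0) h
    have h1 := Int.emod_lt_abs (M 0 0) h
    rw [← Int.natAbs_abs (M 1 0)]
    exact Int.natAbs_lt_natAbs_of_nonneg_of_lt h0 h1
  omega

theorem col_reduce : ∀ (n : ℕ) (M : M3), μ M = n → ∃ P ∈ C, (P * M) 1 0 = 0 ∧ (P * M) 2 0 = 0 := by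
  intro n
  induction n using Nat.strong_induction_on with
  | _ n ih =>
    intro M hM
    by_cases h1 : M 1 0 = 0
    · by_cases h2 : M 2 0 = 0
      · exact ⟨1, Submonoid.one_mem _, by simpa using h1, by simpa using h2⟩
      · have hM₁ : (Pswap 1 2 * M) 1 0 ≠ 0 := by
          rwa [Pswap_mul_apply, Equiv.swap_apply_left]
        have hμ : μ (Pswap 1 2 * M) = μ M := by
          unfold μ
          rw [Pswap_mul_apply, Pswap_mul_apply, Equiv.swap_apply_left, Equiv.swap_apply_right,
            add_comm]
        obtain ⟨P, hP, hlt⟩ := step _ hM₁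
        obtain ⟨P', hP', h⟩ := ih _ (by rw [← hM, ← hμ]; exact hlt) (P * (Pswap 1 2 * M)) rfl
        refine ⟨P' * P * Pswap 1 2,
          Submonoid.mul_mem _ (Submonoid.mul_mem _ hP' hP) (Pswap_mem 1 2), ?_⟩
        simpa [mul_assoc] using h
    · obtain ⟨P, hP, hlt⟩ := step M h1
      obtain ⟨P', hP', h⟩ := ih _ (by rw [← hM]; exact hlt) (P * M) rfl
      exact ⟨P' * P, Submonoid.mul_mem _ hP' hP, by simpa [mul_assoc] using h⟩

/-! ## The `SL(2,ℤ)` block -/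

/-- Block embedding `X ↦ 1 ⊕ X`. -/
def emb (X : Matrix (Fin 2) (Fin 2) ℤ) : M3 :=
  !![1, 0, 0; 0, X 0 0, X 0 1; 0, X 1 0, X 1 1]

theorem emb_one : emb 1 = 1 := by
  ext i j
  fin_cases i <;> fin_cases j <;> rfl

theorem emb_mul (X Y : Matrix (Fin 2) (Fin 2) ℤ) : emb (X * Y) = emb X * emb Y := by
  ext i j
  fin_cases i <;> fin_cases j <;>
    simp [emb, Matrix.mul_apply, Fin.sum_univ_three, Fin.sum_univ_two]

theorem emb_S : emb (ModularGroup.S : Matrix (Fin 2) (Fin 2) ℤ) = Pswap 1 2 * signMat 2 := by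
  rw [ModularGroup.coe_S]
  ext i j
  rw [Matrix.mul_apply, Fin.sum_univ_three]
  fin_cases i <;> fin_cases j <;> simp [emb, Pswap_apply, signMat, Matrix.diagonal, Equiv.swap_apply_def]

theorem emb_S_inv :
    emb ((ModularGroup.S⁻¹ : SL(2, ℤ)) : Matrix (Fin 2) (Fin 2) ℤ) = signMat 2 * Pswap 1 2 := by
  rw [Matrix.SpecialLinearGroup.coe_inv, ModularGroup.coe_S, Matrix.adjugate_fin_two]
  ext i j
  rw [Matrix.mul_apply, Fin.sum_univ_three]
  fin_cases i <;> fin_cases j <;> simp [emb, Pswap_apply, signMat, Matrix.diagonal, Equiv.swap_apply_def]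

theorem emb_T : emb (ModularGroup.T : Matrix (Fin 2) (Fin 2) ℤ) = Matrix.transvection 1 2 1 := by
  rw [ModularGroup.coe_T]
  ext i j
  fin_cases i <;> fin_cases j <;>
    simp [emb, Matrix.transvection, Matrix.single, Matrix.of_apply]

theorem emb_T_inv :
    emb ((ModularGroup.T⁻¹ : SL(2, ℤ)) : Matrix (Fin 2) (Fin 2) ℤ) = Matrix.transvection 1 2 (-1) := by
  rw [ModularGroup.coe_T_inv]
  ext i j
  fin_cases i <;> fin_cases j <;>
    simp [emb, Matrix.transvection, Matrix.single, Matrix.of_apply]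

theorem emb_mem (X : SL(2, ℤ)) : emb (X : Matrix (Fin 2) (Fin 2) ℤ) ∈ C := by
  have hX : X ∈ Subgroup.closure ({ModularGroup.S, ModularGroup.T} : Set (SL(2, ℤ))) := by
    rw [SpecialLinearGroup.SL2Z_generators]; trivial
  suffices h : emb (X : Matrix (Fin 2) (Fin 2) ℤ) ∈ C ∧
      emb ((X⁻¹ : SL(2, ℤ)) : Matrix (Fin 2) (Fin 2) ℤ) ∈ C from h.1
  induction hX using Subgroup.closure_induction with
  | mem x hx =>
    rcases hx with rfl | rfl
    · rw [emb_S, emb_S_inv]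
      exact ⟨Submonoid.mul_mem _ (Pswap_mem 1 2) (signMat_mem 2),
        Submonoid.mul_mem _ (signMat_mem 2) (Pswap_mem 1 2)⟩
    · rw [emb_T, emb_T_inv]
      exact ⟨transvection_mem 1 2 (by decide) 1, transvection_mem 1 2 (by decide) (-1)⟩
  | one =>
    rw [inv_one, Matrix.SpecialLinearGroup.coe_one, emb_one]
    exact ⟨Submonoid.one_mem _, Submonoid.one_mem _⟩
  | mul x y _ _ hx hy =>
    rw [mul_inv_rev, Matrix.SpecialLinearGroup.coe_mul, Matrix.SpecialLinearGroup.coe_mul,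
      emb_mul, emb_mul]
    exact ⟨Submonoid.mul_mem _ hx.1 hy.1, Submonoid.mul_mem _ hy.2 hx.2⟩
  | inv x _ hx =>
    rw [inv_inv]
    exact ⟨hx.2, hx.1⟩

/-! ## Assembly -/

/-- A matrix with first row and column `(1,0,0)` is the block embedding of its minor. -/
theorem eq_emb (N : M3) (h00 : N 0 0 = 1) (h01 : N 0 1 = 0) (h02 : N 0 2 = 0) (h10 : N 1 0 = 0)
    (h20 : N 2 0 = 0) : N = emb !![N 1 1, N 1 2; N 2 1, N 2 2] := by
  ext i j
  fin_cases i <;> fin_cases j <;> simp [emb, h00, h01, h02, h10, h20]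

theorem det_of_shape (N : M3) (h01 : N 0 1 = 0) (h02 : N 0 2 = 0) :
    N.det = N 0 0 * (N 1 1 * N 2 2 - N 1 2 * N 2 1) := by
  rw [Matrix.det_fin_three, h01, h02]
  ring

/-- **`GL₃(ℤ) ⊆ ⟨Nielsen matrices⟩` (as a monoid).** -/
theorem mem_closure_of_isUnit_det (M : M3) (hM : IsUnit M.det) : M ∈ Submonoid.closure nielsenGens := by
  -- 1. column reduction
  obtain ⟨P, hP, h10, h20⟩ := col_reduce (μ M) M rfl
  set N := P * M with hN
  have hNdet : IsUnit N.det := by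
    rw [hN, Matrix.det_mul]; exact (isUnit_det_of_mem hP).mul hM
  -- 2. clear the first row by column operations
  set ε : ℤ := N 0 0 with hε
  set R : M3 := Matrix.transvection 0 1 (-(ε * N 0 1)) * Matrix.transvection 0 2 (-(ε * N 0 2)) with hR
  have hRmem : R ∈ C :=
    Submonoid.mul_mem _ (transvection_mem 0 1 (by decide) _) (transvection_mem 0 2 (by decide) _)
  set N₂ := N * R with hN₂
  have hεu : ε = 1 ∨ ε = -1 := by
    -- `ε ∣ det N` (the first column is `(ε,0,0)`) and `det N` is a unit
    have hdvd : ε ∣ N.det := by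
      rw [Matrix.det_fin_three, h10, h20]
      exact ⟨N 1 1 * N 2 2 - N 1 2 * N 2 1, by ring⟩
    exact Int.isUnit_iff.1 (isUnit_of_dvd_unit hdvd hNdet)
  have hε1 : ε * ε = 1 := by rcases hεu with h | h <;> simp [h]
  have c00 : N₂ 0 0 = ε := by
    rw [hN₂, hR, ← Matrix.mul_assoc, Matrix.mul_transvection_apply_of_ne 0 2 0 0 (by decide),
      Matrix.mul_transvection_apply_of_ne 0 1 0 0 (by decide)]
  have c10 : N₂ 1 0 = 0 := by
    rw [hN₂, hR, ← Matrix.mul_assoc, Matrix.mul_transvection_apply_of_ne 0 2 1 0 (by decide),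
      Matrix.mul_transvection_apply_of_ne 0 1 1 0 (by decide), h10]
  have c20 : N₂ 2 0 = 0 := by
    rw [hN₂, hR, ← Matrix.mul_assoc, Matrix.mul_transvection_apply_of_ne 0 2 2 0 (by decide),
      Matrix.mul_transvection_apply_of_ne 0 1 2 0 (by decide), h20]
  have c01 : N₂ 0 1 = 0 := by
    rw [hN₂, hR, ← Matrix.mul_assoc, Matrix.mul_transvection_apply_of_ne 0 2 0 1 (by decide),
      Matrix.mul_transvection_apply_same 0 1 0]
    rw [← hε]
    linear_combination (-(N 0 1)) * hε1
  have c02 : N₂ 0 2 = 0 := by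
    rw [hN₂, hR, ← Matrix.mul_assoc, Matrix.mul_transvection_apply_same 0 2 0,
      Matrix.mul_transvection_apply_of_ne 0 1 0 2 (by decide),
      Matrix.mul_transvection_apply_of_ne 0 1 0 0 (by decide)]
    rw [← hε]
    linear_combination (-(N 0 2)) * hε1
  -- 3. fix the sign of the corner: L₁ := signMat 0 if ε = -1
  obtain ⟨L₁, hL₁, d00, d01, d02, d10, d20⟩ : ∃ L₁ ∈ C, (L₁ * N₂) 0 0 = 1 ∧ (L₁ * N₂) 0 1 = 0 ∧
      (L₁ * N₂) 0 2 = 0 ∧ (L₁ * N₂) 1 0 = 0 ∧ (L₁ * N₂) 2 0 = 0 := by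
    rcases hεu with h | h
    · exact ⟨1, Submonoid.one_mem _, by rw [Matrix.one_mul, c00, h], by simp [c01], by simp [c02],
        by simp [c10], by simp [c20]⟩
    · refine ⟨signMat 0, signMat_mem 0, ?_, ?_, ?_, ?_, ?_⟩
      · rw [signMat_mul_apply, c00, h]; decide
      all_goals simp [signMat_mul_apply, c01, c02, c10, c20]
  set N₃ := L₁ * N₂ with hN₃
  have hN₃det : IsUnit N₃.det := by
    rw [hN₃, hN₂, Matrix.det_mul, Matrix.det_mul]
    exact (isUnit_det_of_mem hL₁).mul (hNdet.mul (isUnit_det_of_mem hRmem))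
  -- 4. fix the sign of the block determinant: L₂ := signMat 1 if the minor has det -1
  have hminor : IsUnit (N₃ 1 1 * N₃ 2 2 - N₃ 1 2 * N₃ 2 1) := by
    have := det_of_shape N₃ d01 d02
    rw [d00, one_mul] at this
    rwa [← this]
  obtain ⟨L₂, hL₂, f00, f01, f02, f10, f20, fdet⟩ : ∃ L₂ ∈ C, (L₂ * N₃) 0 0 = 1 ∧ (L₂ * N₃) 0 1 = 0 ∧
      (L₂ * N₃) 0 2 = 0 ∧ (L₂ * N₃) 1 0 = 0 ∧ (L₂ * N₃) 2 0 = 0 ∧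
      (L₂ * N₃) 1 1 * (L₂ * N₃) 2 2 - (L₂ * N₃) 1 2 * (L₂ * N₃) 2 1 = 1 := by
    rcases Int.isUnit_iff.1 hminor with h | h
    · exact ⟨1, Submonoid.one_mem _, by simp [d00], by simp [d01], by simp [d02], by simp [d10],
        by simp [d20], by simpa using h⟩
    · refine ⟨signMat 1, signMat_mem 1, ?_, ?_, ?_, ?_, ?_, ?_⟩ <;>
        simp [signMat_mul_apply, d00, d01, d02, d10, d20]
      linear_combination (-1 : ℤ) * h
  set N₄ := L₂ * N₃ with hN₄
  -- 5. the block is in SL(2,ℤ)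
  let B : SL(2, ℤ) := ⟨!![N₄ 1 1, N₄ 1 2; N₄ 2 1, N₄ 2 2], by
    rw [Matrix.det_fin_two_of]; exact fdet⟩
  have hN₄emb : N₄ = emb (B : Matrix (Fin 2) (Fin 2) ℤ) := eq_emb N₄ f00 f01 f02 f10 f20
  have hN₄mem : N₄ ∈ C := hN₄emb ▸ emb_mem B
  -- 6. unwind: N₄ = (L₂ * L₁ * P) * M * R
  have : L₂ * L₁ * P * M * R = N₄ := by
    simp only [hN₄, hN₃, hN₂, hN, Matrix.mul_assoc]
  exact mem_of_mul_mem (Submonoid.mul_mem _ (Submonoid.mul_mem _ hL₂ hL₁) hP) hRmem (this ▸ hN₄mem)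

end Summit.SmoothPoincare4.SmoothPoincare4.Cruxes.ShadowApproximation.EpiClassLivingston.GL3Gen


namespace Summit.SmoothPoincare4.SmoothPoincare4.Cruxes.ShadowApproximation.EpiClassLivingston

/-- **Nielsen: every invertible integer `3 × 3` matrix is the abelianisation of an automorphism of
`F₃`** — the registered stub `stub_autFreeGroupRealisesGL`, verbatim. -/
theorem autFreeGroupRealisesGL :
    ∀ M : Matrix (Fin 3) (Fin 3) ℤ, IsUnit M.det →
      ∃ θ : FreeGroup (Fin 3) ≃* FreeGroup (Fin 3), ∀ i j : Fin 3,
        Multiplicative.toAdd (FreeGroup.lift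
          (fun k : Fin 3 => Multiplicative.ofAdd (Pi.single k (1 : ℤ) : Fin 3 → ℤ))
          (θ (FreeGroup.of i))) j = M i j :=
  NielsenMoves.stub_1b_of_generation fun M hM => GL3Gen.mem_closure_of_isUnit_det M hM

end Summit.SmoothPoincare4.SmoothPoincare4.Cruxes.ShadowApproximation.EpiClassLivingston

end
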